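import Summits.Langlands.Langlands.Theorems.PhantomRMYoshidaResiduallyYoshidaLiftingGreenbergSelmerDefs
import Summits.Langlands.Langlands.Theorems.PhantomRMYoshidaResiduallyYoshidaLiftingRealisedClassSelmerDec
import Summits.Langlands.Langlands.Theorems.PhantomRMYoshidaResiduallyYoshidaLiftingSelmerAnchorRelOfRankOneDec
import Summits.Langlands.Langlands.Theorems.PhantomRMYoshidaResiduallyYoshidaLiftingResidualConstancyOfRankOne
import HarnessLib

/-!
# Route `PhantomRMYoshida`, crux `ResiduallyYoshidaLifting` (stmt-Langlands-13639), line `sector-klingen-split`: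
# stubs KV1–KV3 — K3⁺ / K2⁺ / RC restated over the Greenberg–Selmer VOCABULARY (short, citable forms)

Lead prover-line-stmt-Langlands-13639-c5-0 (continuation c5, skeleton rev 15, sub-goals KV1 `stub_realisedClass_isGreenbergSelmer`,
KV2 `stub_selmerAnchorRel_of_rankLeOne`, KV3 `stub_residualConstancy_of_rankLeOne`; registered signatures verbatim).

The definitions module `Theorems/…GreenbergSelmerDefs` (p170860) names the explicit-cocycle currency of the line:
`IsRealisedThrough p k red σ σ' r B` ("`r` realises `B` through an integral frame"), `IsCoboundaryFor σ σ' B`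
(`B = σ̄ X - X σ̄'`), `IsGreenbergDecAt p k σ σ' v B` (the nine-clause decomposition-group Greenberg condition at `v ∣ p`),
`IsGreenbergSelmerCocycle p k σ σ' S B` (1-cocycle, locally constant, unramified outside `S`, `IsGreenbergDecAt` at every
`v ∣ p`) and `GreenbergSelmerRankLeOne p k σ σ' S` (any two non-coboundary Greenberg–Selmer cocycles are projectively equal
modulo coboundaries).  This file restates three LANDED theorems of the line over that vocabulary:

* **KV1 (`stub_realisedClass_isGreenbergSelmer`).**  The class realised (`IsRealisedThrough`) by an `Sh`-point `ρ` on a `DetC`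
  fibre (`p ≠ 2`) is an `IsGreenbergSelmerCocycle` for any `S` outside which `ρ` is unramified — the landed K3⁺
  `Fibre.stub_realisedClassSelmerDec` (p168375), whose third component is quantified over `ρ.IsUnramifiedAt v`.
* **KV2 (`stub_selmerAnchorRel_of_rankLeOne`).**  On an admissible fibre carrying the crux's anchor `ρ₀`, under
  `GreenbergSelmerRankLeOne p k σ σ' S`, every non-trivial class realised by an `Sh`-point unramified outside `S` (with `ρ₀`
  unramified outside `S`) is realised by an irreducible automorphic Klingen-ordinary `ρ₁` (`ρ₁ := ρ₀`, `c = 1`) — the landed K2⁺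
  `Fibre.stub_selmerAnchorRel_of_rankOneDec` (p169418), whose `let GrDec` / `let Real` are the bodies of `IsGreenbergDecAt` /
  `IsRealisedThrough` and whose pairwise rank-one hypothesis follows from `GreenbergSelmerRankLeOne`.
* **KV3 (`stub_residualConstancy_of_rankLeOne`).**  Under `GreenbergSelmerRankLeOne p k σ σ' S`, two `Sh`-points unramified
  outside `S` whose integral frames realise non-trivial classes have `GL₄(k)`-conjugate residual representations — the landed RC
  `Fibre.stub_residualConstancyOfRankOne` (p170002) the same way.

**Proofs.**  Definitional unfolding (`IsRealisedThrough`, `IsCoboundaryFor`, `IsGreenbergDecAt`, `IsGreenbergSelmerCocycle`,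
`GreenbergSelmerRankLeOne` are `def`s whose bodies are literally the spelled-out clauses of the landed statements) and re-plumbing of
hypotheses; the one non-trivial re-plumbing — `GreenbergSelmerRankLeOne` implies the PAIRWISE rank-one hypothesis of K2⁺/RC (joint
unramified-vanishing and joint `GrDec` for the pair `(B₁, B₂)`) — is the private `rankLeOne_pairwise`.  No new definitions, no named
fact taken as a hypothesis, no `sorry`.
-/

noncomputable section

-- `Summit.Langlands.Langlands.…` (summit = sub-problem name, D-0017 layout) trips `dupNamespace` on every decl.
set_option linter.dupNamespace false
set_option autoImplicit false

open IsDedekindDomain Filter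
open scoped Matrix
open Literature.NumberTheory.GaloisRepresentations Literature.NumberTheory.Automorphic
open Summit.Langlands.Langlands.Cruxes.ResiduallyYoshidaLifting.YoshidaDivisorSelmerCount

namespace Summit.Langlands.Langlands.Cruxes.ResiduallyYoshidaLifting.SectorKlingenSplit.Fibre

/-- `GreenbergSelmerRankLeOne` (rank at most one of the Greenberg–Selmer space with ramification inside `S`, stated for two
`IsGreenbergSelmerCocycle`s that are not `IsCoboundaryFor`) implies the PAIRWISE rank-one hypothesis in which the landed K2⁺
(`stub_selmerAnchorRel_of_rankOneDec`) and RC (`stub_residualConstancyOfRankOne`) are stated: the joint hypotheses on the pair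
`(B₁, B₂)` split into the two `IsGreenbergSelmerCocycle` bundles. [folklore] -/
private theorem rankLeOne_pairwise {p : ℕ} [Fact p.Prime] {k : Type} [Field k] [TopologicalSpace k]
    {σ σ' : FramedGaloisRep ℚ k 2} {S : Set (HeightOneSpectrum (NumberField.RingOfIntegers ℚ))}
    (hrank : GreenbergSelmerRankLeOne p k σ σ' S) :
    ∀ B₁ B₂ : Field.absoluteGaloisGroup ℚ → Matrix (Fin 2) (Fin 2) k,
      (∀ g g', B₁ (g * g') = (σ g).val * B₁ g' + B₁ g * (σ' g').val) →
      (∀ g g', B₂ (g * g') = (σ g).val * B₂ g' + B₂ g * (σ' g').val) →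
      IsLocallyConstant B₁ → IsLocallyConstant B₂ →
      (∀ v ∉ S, ∀ 𝔓 ∈ v.primesAbove, ∀ i ∈ 𝔓.inertia (Field.absoluteGaloisGroup ℚ), B₁ i = 0 ∧ B₂ i = 0) →
      (∀ v : HeightOneSpectrum (NumberField.RingOfIntegers ℚ), ((p : ℕ) : NumberField.RingOfIntegers ℚ) ∈ v.asIdeal →
        IsGreenbergDecAt p k σ σ' v B₁ ∧ IsGreenbergDecAt p k σ σ' v B₂) →
      ¬ IsCoboundaryFor σ σ' B₁ → ¬ IsCoboundaryFor σ σ' B₂ →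
      ∃ (c : kˣ) (X : Matrix (Fin 2) (Fin 2) k), ∀ g, B₂ g = (c : k) • B₁ g + ((σ g).val * X - X * (σ' g).val) :=
  fun B₁ B₂ hcoc₁ hcoc₂ hlc₁ hlc₂ hur hgr hB₁ hB₂ =>
    hrank B₁ B₂ ⟨hcoc₁, hlc₁, fun v hv 𝔓 h𝔓 i hi => (hur v hv 𝔓 h𝔓 i hi).1, fun v hv => (hgr v hv).1⟩
      ⟨hcoc₂, hlc₂, fun v hv 𝔓 h𝔓 i hi => (hur v hv 𝔓 h𝔓 i hi).2, fun v hv => (hgr v hv).2⟩ hB₁ hB₂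

/-- **Registered sub-goal KV1 `stub_realisedClass_isGreenbergSelmer`** (crux stmt-Langlands-13639, line `sector-klingen-split`,
skeleton rev 15; K3⁺ p168375 over the vocabulary p170860): the class realised by an `Sh`-point `ρ` on a `DetC` fibre (`p ≠ 2`) is a
Greenberg–Selmer cocycle with ramification inside any `S` outside which `ρ` is unramified — unfold `IsRealisedThrough` to an integral
frame `(P, rint, h)`, apply `Fibre.stub_realisedClassSelmerDec`, and restrict its unramified-vanishing component to `v ∉ S`. [folklore] -/
theorem stub_realisedClass_isGreenbergSelmer :
    ∀ (p : ℕ) [Fact p.Prime], p ≠ 2 → ∀ (k : Type) [Field k] [CharP k p] [IsAlgClosed k]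
      [TopologicalSpace k] [DiscreteTopology k] (red : Valued.integer (PadicAlgCl p) →+* k)
      (σ σ' : FramedGaloisRep ℚ k 2) (ρ : FramedGaloisRep ℚ (PadicAlgCl p) 4)
      (B : Field.absoluteGaloisGroup ℚ → Matrix (Fin 2) (Fin 2) k)
      (S : Set (HeightOneSpectrum (NumberField.RingOfIntegers ℚ))),
      DetC p k σ σ' → Sh p k red σ σ' ρ → IsRealisedThrough p k red σ σ' ρ B →
      (∀ v ∉ S, ρ.IsUnramifiedAt v) → IsGreenbergSelmerCocycle p k σ σ' S B := by
  intro p _ hp k _ _ _ _ _ red σ σ' ρ B S hDet hSh hreal hS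
  obtain ⟨P, rint, h, hP, hred⟩ := hreal
  obtain ⟨hcoc, hlc, hur, hgr⟩ := stub_realisedClassSelmerDec p hp k red σ σ' ρ P rint h B hDet hSh hP hred
  exact ⟨hcoc, hlc, fun v hv => hur v (hS v hv), hgr⟩

/-- **Registered sub-goal KV2 `stub_selmerAnchorRel_of_rankLeOne`** (crux stmt-Langlands-13639, line `sector-klingen-split`,
skeleton rev 15; K2⁺ p169418 over the vocabulary p170860): on an admissible fibre (`σ̄, σ̄'` irreducible, non-conjugate, `DetC`,
`p ≠ 2`) carrying the crux's anchor `ρ₀` (irreducible, `Sh`, `Aut`), if the Greenberg–Selmer space with ramification inside `S` has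
rank at most one (`GreenbergSelmerRankLeOne`), every class that is not a coboundary (`¬ IsCoboundaryFor`) and is realised
(`IsRealisedThrough`) by an `Sh`-point unramified outside `S` (with `ρ₀` unramified outside `S` too) is realised by an irreducible,
automorphic, symplectic, Klingen-ordinary and residually distinguished `ρ₁` (`ρ₁ := ρ₀`, `c = 1`) —
`Fibre.stub_selmerAnchorRel_of_rankOneDec` with its `let GrDec` / `let Real` read as `IsGreenbergDecAt` / `IsRealisedThrough` and its
pairwise rank-one hypothesis supplied by `rankLeOne_pairwise`. [folklore] -/
theorem stub_selmerAnchorRel_of_rankLeOne :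
    ∀ (p : ℕ) [Fact p.Prime], p ≠ 2 → ∀ (k : Type) [Field k] [CharP k p] [IsAlgClosed k]
      [TopologicalSpace k] [DiscreteTopology k] (red : Valued.integer (PadicAlgCl p) →+* k)
      (σ σ' : FramedGaloisRep ℚ k 2) (hcpt : isCompact_glFiniteIntegralLevel 4 ℚ) (ι : PadicAlgCl p ≃+* ℂ)
      (ρ₀ ρ : FramedGaloisRep ℚ (PadicAlgCl p) 4) (B : Field.absoluteGaloisGroup ℚ → Matrix (Fin 2) (Fin 2) k)
      (S : Set (HeightOneSpectrum (NumberField.RingOfIntegers ℚ))),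
      σ.toGaloisRep.IsIrreducible → σ'.toGaloisRep.IsIrreducible → DetC p k σ σ' →
      (¬ ∃ g : GL (Fin 2) k, ∀ x, g * σ x * g⁻¹ = σ' x) →
      ρ₀.toGaloisRep.IsIrreducible → Sh p k red σ σ' ρ₀ → Aut p hcpt ι ρ₀ →
      ¬ IsCoboundaryFor σ σ' B → Sh p k red σ σ' ρ → IsRealisedThrough p k red σ σ' ρ B →
      (∀ v ∉ S, ρ.IsUnramifiedAt v ∧ ρ₀.IsUnramifiedAt v) → GreenbergSelmerRankLeOne p k σ σ' S →
      ∃ ρ₁ : FramedGaloisRep ℚ (PadicAlgCl p) 4, ρ₁.toGaloisRep.IsIrreducible ∧ Aut p hcpt ι ρ₁ ∧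
        (∃ c : ℕ, (c : ZMod (p - 1)) = 1 ∧
          (∃ ν : Field.absoluteGaloisGroup ℚ → PadicAlgCl p, ρ₁.IsSymplecticWithMultiplierFun ν) ∧
          ∀ v : HeightOneSpectrum (NumberField.RingOfIntegers ℚ), ((p : ℕ) : NumberField.RingOfIntegers ℚ) ∈ v.asIdeal →
            ρ₁.IsGreenbergOrdinaryOfShapeAt v ![0, 0, c, c] ∧ ρ₁.IsResiduallyDistinguishedAt v ![0, 0, c, c]) ∧
        IsRealisedThrough p k red σ σ' ρ₁ B := by
  intro p _ hp k _ _ _ _ _ red σ σ' hcpt ι ρ₀ ρ B S hσ hσ' hdet hnc hρ₀ hSh₀ hA₀ hB hSh hreal hS hrank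
  exact stub_selmerAnchorRel_of_rankOneDec p hp k red σ σ' hcpt ι ρ₀ ρ B S hσ hσ' hdet hnc hρ₀ hSh₀ hA₀ hB hSh hreal hS
    (rankLeOne_pairwise hrank)

/-- **Registered sub-goal KV3 `stub_residualConstancy_of_rankLeOne`** (crux stmt-Langlands-13639, line `sector-klingen-split`,
skeleton rev 15; RC p170002 over the vocabulary p170860): if the Greenberg–Selmer space with ramification inside `S` has rank at
most one (`GreenbergSelmerRankLeOne`), any two `Sh`-points `ρ₁, ρ₂` on a `DetC` fibre (`p ≠ 2`), unramified outside `S`, whose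
integral frames `(P₁, rint₁, h₁)`, `(P₂, rint₂, h₂)` realise classes `B₁, B₂` that are not coboundaries (`¬ IsCoboundaryFor`) have
`GL₄(k)`-CONJUGATE residual representations `red ∘ rint₂ = g (red ∘ rint₁) g⁻¹` — `Fibre.stub_residualConstancyOfRankOne` with its
`let GrDec` read as `IsGreenbergDecAt`, its `let Fr` fed by the frame hypotheses, and its pairwise rank-one hypothesis supplied by
`rankLeOne_pairwise`. [folklore] -/
theorem stub_residualConstancy_of_rankLeOne :
    ∀ (p : ℕ) [Fact p.Prime], p ≠ 2 → ∀ (k : Type) [Field k] [CharP k p] [IsAlgClosed k]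
      [TopologicalSpace k] [DiscreteTopology k] (red : Valued.integer (PadicAlgCl p) →+* k)
      (σ σ' : FramedGaloisRep ℚ k 2) (ρ₁ ρ₂ : FramedGaloisRep ℚ (PadicAlgCl p) 4) (P₁ P₂ : GL (Fin 4) (PadicAlgCl p))
      (rint₁ rint₂ : Field.absoluteGaloisGroup ℚ →* GL (Fin 4) (Valued.integer (PadicAlgCl p))) (h₁ h₂ : GL (Fin 4) k)
      (B₁ B₂ : Field.absoluteGaloisGroup ℚ → Matrix (Fin 2) (Fin 2) k) (S : Set (HeightOneSpectrum (NumberField.RingOfIntegers ℚ))),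
      DetC p k σ σ' → Sh p k red σ σ' ρ₁ → Sh p k red σ σ' ρ₂ →
      (∀ g, Matrix.GeneralLinearGroup.map (Valued.integer (PadicAlgCl p)).subtype (rint₁ g) = P₁⁻¹ * ρ₁ g * P₁) →
      (∀ g, (Matrix.GeneralLinearGroup.map red (rint₁ g)).val =
          h₁.val * Matrix.reindex finSumFinEquiv finSumFinEquiv
            (Matrix.fromBlocks (σ g).val (B₁ g) 0 (σ' g).val) * (h₁⁻¹).val) →
      (∀ g, Matrix.GeneralLinearGroup.map (Valued.integer (PadicAlgCl p)).subtype (rint₂ g) = P₂⁻¹ * ρ₂ g * P₂) →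
      (∀ g, (Matrix.GeneralLinearGroup.map red (rint₂ g)).val =
          h₂.val * Matrix.reindex finSumFinEquiv finSumFinEquiv
            (Matrix.fromBlocks (σ g).val (B₂ g) 0 (σ' g).val) * (h₂⁻¹).val) →
      ¬ IsCoboundaryFor σ σ' B₁ → ¬ IsCoboundaryFor σ σ' B₂ →
      (∀ v ∉ S, ρ₁.IsUnramifiedAt v ∧ ρ₂.IsUnramifiedAt v) → GreenbergSelmerRankLeOne p k σ σ' S →
      ∃ g : GL (Fin 4) k, ∀ γ,
        Matrix.GeneralLinearGroup.map red (rint₂ γ) = g * Matrix.GeneralLinearGroup.map red (rint₁ γ) * g⁻¹ := by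
  intro p _ hp k _ _ _ _ _ red σ σ' ρ₁ ρ₂ P₁ P₂ rint₁ rint₂ h₁ h₂ B₁ B₂ S hdet hSh₁ hSh₂ hP₁ hred₁ hP₂ hred₂
    hB₁ hB₂ hS hrank
  exact stub_residualConstancyOfRankOne p hp k red σ σ' ρ₁ ρ₂ P₁ P₂ rint₁ rint₂ h₁ h₂ B₁ B₂ S hdet hSh₁ hSh₂
    ⟨hP₁, hred₁⟩ ⟨hP₂, hred₂⟩ hB₁ hB₂ hS (rankLeOne_pairwise hrank)

end Summit.Langlands.Langlands.Cruxes.ResiduallyYoshidaLifting.SectorKlingenSplit.Fibre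

end
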